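import Summits.BirchSwinnertonDyer.BirchSwinnertonDyer.Theorems.Rank2ObservatoryThreeIsoPrimes
import HarnessLib

/-!
# BirchSwinnertonDyer — rank ≥ 2 observatory: KERNEL-3ISO per-row kit (coordinates, non-association, counts)

HONEST FRAMING: per-curve certified theorems and census instruments; no claim on BSD in rank ≥ 2.

The per-row files `Rank2Observatory<label>RankTwo.lean` of the cert-1 KERNEL-3ISO leg (rank-2 census rows
with `E(ℚ)_tors = ℤ/3`, `3`-isogeny descent over `K = ℚ(ζ₃)`) share three row-independent steps. They are
proved here ONCE, so that no per-row file restates an already-landed declaration: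

* `coords_eq_iff` — integer coordinates on `1, η` (`η = hζ.toInteger`) are unique, in the product form
  `a + bη = c + dη ↔ (a, b) = (c, d)` that `simp +decide` uses for membership, distinctness and the
  `if`-chains over a literal prime family `P ⊂ 𝓞 K`;
* `not_associated_of_norm_form_not_dvd` — `a + bη` and `c + dη` are not associated as soon as the norm form
  `a² - ab + b²` does not divide the norm form of their SUM; for a split pair `π_ℓ = x + yη`,
  `π̄_ℓ = (x - y) - yη` the sum is `2x - y ∈ ℤ` and the test is `ℓ ∤ (2x - y)²`, a `norm_num` fact;
* `card_image_le_of_card_le` — `#(s.image f) ≤ n` from `#s ≤ n` with the bound `n` supplied explicitly,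
  so that the two class counts of a row close by `decide` / `simp` on literal finsets.

No definitions; no `native_decide`; axioms standard.
References: H. Cohen, *Number Theory I* (GTM 239, 2007), Prop. 8.4.8; H. Cohen, F. Pazuki,
arXiv:0903.4963, §2 (arithmetic of `ℤ[ζ₃]`). [folklore]
-/

set_option linter.dupNamespace false

namespace Summit.BirchSwinnertonDyer.BirchSwinnertonDyer.Rank2Observatory.ThreeIso

open NumberField

/-- An image of a finset with at most `n` elements has at most `n` elements (bound explicit). [folklore] -/
theorem card_image_le_of_card_le {α β : Type*} [DecidableEq β] {s : Finset α} (n : ℕ)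
    (h : s.card ≤ n) (f : α → β) : (s.image f).card ≤ n :=
  Finset.card_image_le.trans h

variable {K : Type*} [Field K] [NumberField K] [IsCyclotomicExtension {3} ℚ K] {ζ : K}
  (hζ : IsPrimitiveRoot ζ 3)

omit [IsCyclotomicExtension {3} ℚ K] in
/-- Integer coordinates on `1, η` are unique, product form (membership / distinctness in a literal prime
family by `decide` on `ℤ × ℤ`). [folklore] -/
theorem coords_eq_iff {a b c d : ℤ} :
    (a : 𝓞 K) + b * hζ.toInteger = (c : 𝓞 K) + d * hζ.toInteger ↔ (a, b) = (c, d) :=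
  ⟨fun he => Prod.ext_iff.mpr (int_coords_unique hζ he), fun h => by
    obtain ⟨rfl, rfl⟩ := Prod.ext_iff.mp h
    rfl⟩

/-- **Non-association through the sum**: if the norm form of `a + bη` does not divide the norm form of
`(a + bη) + (c + dη)`, the two elements are not associated (`Associated x y ⇒ x ∣ x + y`). For a split
pair `π = x + yη`, `π̄ = (x - y) - yη` of norm `ℓ` this is the test `ℓ ∤ (2x - y)²`. [folklore] -/
theorem not_associated_of_norm_form_not_dvd {a b c d : ℤ}
    (h : ¬ a ^ 2 - a * b + b ^ 2 ∣ (a + c) ^ 2 - (a + c) * (b + d) + (b + d) ^ 2) :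
    ¬ Associated ((a : 𝓞 K) + b * hζ.toInteger) ((c : 𝓞 K) + d * hζ.toInteger) := by
  intro hassoc
  apply h
  have hsum : ((a : 𝓞 K) + b * hζ.toInteger) + ((c : 𝓞 K) + d * hζ.toInteger)
      = ((a + c : ℤ) : 𝓞 K) + ((b + d : ℤ) : 𝓞 K) * hζ.toInteger := by
    push_cast; ring
  have hdvd : (a : 𝓞 K) + b * hζ.toInteger ∣ ((a + c : ℤ) : 𝓞 K) + ((b + d : ℤ) : 𝓞 K) * hζ.toInteger :=
    hsum ▸ dvd_add (dvd_refl _) hassoc.dvd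
  exact norm_form_dvd_of_dvd hζ hdvd

/-- Sanity instance of the product form: `θ₀ = 1 + 2η ≠ 2 + 0η`. [folklore] -/
example : ¬ ((1 : ℤ) : 𝓞 K) + (2 : ℤ) * hζ.toInteger = ((2 : ℤ) : 𝓞 K) + (0 : ℤ) * hζ.toInteger := by
  simp +decide only [coords_eq_iff hζ, not_false_eq_true]

/-- Sanity instance of the sum test: `π_7 = 3 + 2η` and `π̄_7 = 1 - 2η` are not associated (`7 ∤ 16`).
[folklore] -/
example : ¬ Associated (((3 : ℤ) : 𝓞 K) + (2 : ℤ) * hζ.toInteger)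
    (((1 : ℤ) : 𝓞 K) + (-2 : ℤ) * hζ.toInteger) :=
  not_associated_of_norm_form_not_dvd hζ (by norm_num)

end Summit.BirchSwinnertonDyer.BirchSwinnertonDyer.Rank2Observatory.ThreeIso
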